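import Summits.Ventures.QEC.Census.BZAutPermCover
import HarnessLib

/-!
# `bz_aut` with explicit-permutation automorphisms — CHUNKED label covers (large `k`) and their closers
# (qec row 12, automorphism-orbit reduction; third file after `Census/BZAutPerm.lean`, `Census/BZAutPermCover.lean`)

The tabulated cover `coverAutPermOK` of `BZAutPermCover.lean` probes, for each of the `2^k − 1` non-zero labels, the
listed words until one lands in the cover mask; one kernel evaluation is fine for `k ≤ 12` (the `[[144,12,12]]` cover:
54 s) but not for the `k = 14 … 20` census rows (`2BGA` / `A.1` BB leaders: `6·10^4 … 10^6` labels, `≈ 10` probes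
each in certificate order).  This file makes the cover CHUNKABLE with a uniform glue:

* `ChunkCovered n Ld L gens words blocks lo hi : Prop` — the semantic chunk statement (every non-zero label word
  `lo ≤ v < hi` is in the cover mask, or its probe through some listed word is);
* two checkers establishing a chunk by ONE `decide +kernel`: the search form `coverAutPermRangeOK … lo hi`
  (`chunkCovered_of_rangeOK`; also `chunkCovered_of_coverAutPermOK` for the whole range) and the WITNESSED form
  `coverAutPermWitRangeOK … lo hi witN b` — one probe per label, the word number of label `v` being the `b`-bit field
  `v − lo` of the packed witness `witN` (`witIdx`; `chunkCovered_of_witRangeOK`) — `≈ 10×` fewer probes than the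
  search form at `k = 16`, with `2^k · b / (#chunks)` bits of data per chunk;
* the glue `coverAutPerm_sound_of_chunkCovered` along cut points `cuts = [0, c₁, …, 2^k]` and
  `bzAut_perm_hcover_of_chunkCovered` (= the `hcover` hypothesis of `bzAut_lower_sound` / `_sem` / `_mitm`), and the
  closers `bzAut_perm_lower_of_chunkCovered` (BZ engine) / `bzAut_perm_lower_sem_of_chunkCovered` (lane-agnostic).

USE: per chunk `i` (own theorem, own file if heavy; emitter balances chunks by probe count):

    theorem cov_i : coverAutPermWitRangeOK n LX LZ (autPerms gens) words blocks cᵢ cᵢ₊₁ witNᵢ b = true := by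
      decide +kernel
    -- assembly: hch := fun i hi => by interval_cases i <;> exact chunkCovered_of_witRangeOK cov_‹i›
    … bzAut_perm_lower_of_chunkCovered hcomm hfound hcore hlen hblocks gens_ok words_ok cuts (by simp) rfl rfl hch w hw hw'

HONEST FRAMING: no certificate is read here and no distance value is asserted; tier KERNEL, axioms standard, no
`native_decide`.  Sources as in the companion files ([Grassl 2006 §2.2], [Bravyi et al. 2024 SI §9.2]).
-/

namespace Summit.Ventures.QEC.Census

open Matrix Literature.InformationTheory.QuantumCodes

/-! ## Chunked label covers: a semantic chunk statement, two checkers for it, and the glue -/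

section Chunks

variable {n : ℕ}

/-- **Chunk statement** (semantic): every non-zero label word `lo ≤ v < hi` is in the cover mask directly, or its
probe `xorSel (rhoColsPerm n Ld L (wordPerm n gens w)) v` is, for some listed word `w`.  Each chunk is established
by ONE kernel evaluation of either checker below; chunks along cut points `[0, c₁, …, 2^k]` are glued by
`coverAutPerm_sound_of_chunkCovered` / `bzAut_perm_hcover_of_chunkCovered`. (definition) -/
def ChunkCovered (n : ℕ) (Ld L : List ℕ) (gens words : List (List ℕ)) (blocks : List BZBlock) (lo hi : ℕ) : Prop :=
  ∀ v : ℕ, lo ≤ v → v < hi → v ≠ 0 → (coverMask blocks).testBit v = true ∨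
    ∃ w ∈ words, (coverMask blocks).testBit (xorSel (rhoColsPerm n Ld L (wordPerm n gens w)) v) = true

/-- The range-sharded search form establishes its chunk. -/
theorem chunkCovered_of_rangeOK {Ld L : List ℕ} {gens words : List (List ℕ)} {blocks : List BZBlock} {lo hi : ℕ}
    (h : coverAutPermRangeOK n Ld L gens words blocks lo hi = true) : ChunkCovered n Ld L gens words blocks lo hi := by
  intro v hlo hhi hv0
  simp only [coverAutPermRangeOK, List.all_eq_true, List.mem_range'_1, Bool.or_eq_true, beq_iff_eq,
    List.any_eq_true, List.mem_map] at h
  rcases h v ⟨hlo, by omega⟩ with (h0 | hbit) | ⟨cols, ⟨w, hw, rfl⟩, hbit⟩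
  · exact absurd h0 hv0
  · exact Or.inl hbit
  · exact Or.inr ⟨w, hw, hbit⟩

/-- The whole-range search form establishes the chunk `[0, 2^k)`. -/
theorem chunkCovered_of_coverAutPermOK {Ld L : List ℕ} {gens words : List (List ℕ)} {blocks : List BZBlock}
    (h : coverAutPermOK n Ld L gens words blocks = true) : ChunkCovered n Ld L gens words blocks 0 (2 ^ L.length) := by
  intro v _ hhi hv0
  simp only [coverAutPermOK, List.all_eq_true, List.mem_range, Bool.or_eq_true, beq_iff_eq, List.any_eq_true,
    List.mem_map] at h
  rcases h v hhi with (h0 | hbit) | ⟨cols, ⟨w, hw, rfl⟩, hbit⟩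
  · exact absurd h0 hv0
  · exact Or.inl hbit
  · exact Or.inr ⟨w, hw, hbit⟩

/-- **Packed witness lookup**: the `b`-bit field number `v − lo` of `witN` (`witN = Σ_v idx_v · 2^{b (v − lo)}`).
(definition) -/
def witIdx (witN b lo v : ℕ) : ℕ := witN / 2 ^ (b * (v - lo)) % 2 ^ b

/-- **Witnessed range form** (ONE probe per label): for `lo ≤ v < hi`, `v` is zero, or in the cover mask, or the word
number `witIdx witN b lo v` (packed, `b` bits per label) probes into the cover mask. (definition, `decide +kernel`) -/
def coverAutPermWitRangeOK (n : ℕ) (Ld L : List ℕ) (gens : List (List ℕ)) (words : List (List ℕ))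
    (blocks : List BZBlock) (lo hi witN b : ℕ) : Bool :=
  let cm := coverMask blocks
  let tabs := words.map fun w => rhoColsPerm n Ld L (wordPerm n gens w)
  (List.range' lo (hi - lo)).all fun v =>
    (v == 0) || cm.testBit v ||
      (decide (witIdx witN b lo v < words.length) && cm.testBit (xorSel (tabs.getD (witIdx witN b lo v) []) v))

/-- The witnessed range form establishes its chunk. -/
theorem chunkCovered_of_witRangeOK {Ld L : List ℕ} {gens words : List (List ℕ)} {blocks : List BZBlock}
    {lo hi witN b : ℕ} (h : coverAutPermWitRangeOK n Ld L gens words blocks lo hi witN b = true) :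
    ChunkCovered n Ld L gens words blocks lo hi := by
  intro v hlo hhi hv0
  simp only [coverAutPermWitRangeOK, List.all_eq_true, List.mem_range'_1, Bool.or_eq_true, beq_iff_eq,
    Bool.and_eq_true, decide_eq_true_eq] at h
  rcases h v ⟨hlo, by omega⟩ with (h0 | hbit) | ⟨hidx, hbit⟩
  · exact absurd h0 hv0
  · exact Or.inl hbit
  · refine Or.inr ⟨words[witIdx witN b lo v], List.getElem_mem hidx, ?_⟩
    have htab : (words.map fun w => rhoColsPerm n Ld L (wordPerm n gens w)).getD (witIdx witN b lo v) [] =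
        rhoColsPerm n Ld L (wordPerm n gens words[witIdx witN b lo v]) := by
      rw [List.getD_eq_getElem?_getD, List.getElem?_map, List.getElem?_eq_getElem hidx, Option.map_some,
        Option.getD_some]
    rw [← htab]
    exact hbit

/-- **Glue**: chunk statements along cut points `cuts = [0, c₁, …, 2^k]` give the conclusion of `coverAutPermOK_sound`
(every non-zero label has `P`, or `P (ρ_w *ᵥ λ)` for a listed word `w`). -/
theorem coverAutPerm_sound_of_chunkCovered {Ld L : List ℕ} {gens words : List (List ℕ)} {blocks : List BZBlock}
    (cuts : List ℕ) (hne : cuts ≠ []) (h0 : cuts.head hne = 0) (hlast : cuts.getLast hne = 2 ^ L.length)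
    (hch : ∀ (i : ℕ) (hi : i + 1 < cuts.length), ChunkCovered n Ld L gens words blocks cuts[i] cuts[i + 1])
    (hgens : ∀ g ∈ gens, permListOK n g = true) (hwords : ∀ w ∈ words, ∀ g ∈ w, g < gens.length)
    {P : (Fin L.length → ZMod 2) → Prop}
    (hP : ∀ w : ℕ, (coverMask blocks).testBit w = true → P (ofBits L.length w))
    {Ld' L' : Matrix (Fin L.length) (Fin n) (ZMod 2)}
    (hLd : ∀ i, Ld' i = ofBits n (Ld.getD i 0)) (hL : ∀ j, L' j = ofBits n (L.getD j 0))
    (lam : Fin L.length → ZMod 2) (hlam : lam ≠ 0) :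
    P lam ∨ ∃ w ∈ words, P ((Ld' * (L'.submatrix id (wordEquiv n gens w).symm)ᵀ) *ᵥ lam) := by
  obtain ⟨v, hvlt, rfl⟩ : ∃ v, v < 2 ^ L.length ∧ ofBits L.length v = lam :=
    ⟨toBits lam, toBits_lt lam, ofBits_toBits lam⟩
  have hv0 : v ≠ 0 := by
    rintro rfl
    exact hlam (ofBits_zero _)
  obtain ⟨c, cs, rfl⟩ : ∃ c cs, cuts = c :: cs := by
    cases cuts with
    | nil => exact absurd rfl hne
    | cons c cs => exact ⟨c, cs, rfl⟩
  simp only [List.head_cons] at h0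
  subst h0
  obtain ⟨i, hi, h1, h2⟩ := exists_chunk_of_lt_getLast 0 cs v (Nat.zero_le v) (by rw [hlast]; exact hvlt)
  rcases hch i hi v h1 h2 hv0 with hbit | ⟨w, hw, hbit⟩
  · exact Or.inl (hP v hbit)
  · refine Or.inr ⟨w, hw, ?_⟩
    rw [← ofBits_xorSel_rhoColsPerm hLd hL (wordEquiv n gens w) (wordEquiv_val hgens w (hwords w hw)) v]
    exact hP _ hbit

/-- **`hcover` from chunk statements** along cut points `[0, c₁, …, 2^k]` (each chunk from `chunkCovered_of_rangeOK`
or `chunkCovered_of_witRangeOK` applied to a `decide +kernel` verdict, possibly in its own file): the `hcover`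
hypothesis of `bzAut_lower_sound` / `_sem` / `_mitm` exactly as in `bzAut_perm_hcover`. -/
theorem bzAut_perm_hcover_of_chunkCovered {Hsyn Hstab : List ℕ} {gens : List AutGen}
    (hgens : autGensOK n Hsyn Hstab gens = true)
    {words : List (List ℕ)} (hwords : autWordsOK gens.length words = true)
    {L Ld : List ℕ} {blocks : List BZBlock}
    (cuts : List ℕ) (hne : cuts ≠ []) (h0 : cuts.head hne = 0) (hlast : cuts.getLast hne = 2 ^ L.length)
    (hch : ∀ (i : ℕ) (hi : i + 1 < cuts.length),
      ChunkCovered n Ld L (autPerms gens) words blocks cuts[i] cuts[i + 1]) :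
    ∀ lam : Fin L.length → ZMod 2, lam ≠ 0 →
      (∃ b : Fin blocks.length, lam ∈ Submodule.span (ZMod 2)
        (Set.range fun l : Fin (blocks[b]).W.length => ofBits L.length (blocks[b]).W[l])) ∨
      ∃ (a : {w : List ℕ // w ∈ words}) (b : Fin blocks.length),
        (ldMat n L Ld * (Matrix.submatrix (fun i => logVec n L i : Matrix (Fin L.length) (Fin n) (ZMod 2)) id
            (wordEquiv n (autPerms gens) a.1).symm)ᵀ) *ᵥ lam ∈ Submodule.span (ZMod 2)
          (Set.range fun l : Fin (blocks[b]).W.length => ofBits L.length (blocks[b]).W[l]) := by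
  intro lam hlam
  have hng : (autPerms gens).length = gens.length := List.length_map ..
  rcases coverAutPerm_sound_of_chunkCovered cuts hne h0 hlast hch (permListOK_of_autGensOK hgens)
      (fun w hw => by rw [hng]; exact lt_of_autWordsOK hwords hw)
      (P := fun μ => ∃ b : Fin blocks.length, μ ∈ Submodule.span (ZMod 2)
        (Set.range fun l : Fin (blocks[b]).W.length => ofBits L.length (blocks[b]).W[l]))
      (fun v hv => testBit_coverMask_imp_exists_span _ _ hv)
      (Ld' := ldMat n L Ld) (L' := fun i => logVec n L i) (fun i => rfl)
      (fun j => by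
        change ofBits n L[j] = ofBits n (L.getD j 0)
        rw [List.getD_eq_getElem?_getD, List.getElem?_eq_getElem j.2, Option.getD_some]
        rfl)
      lam hlam with hP | ⟨w, hw, hPw⟩
  · exact Or.inl hP
  · obtain ⟨b, hb⟩ := hPw
    exact Or.inr ⟨⟨w, hw⟩, b, hb⟩

/-- **Closer over chunks, BZ engine** (as `bzAut_perm_lower`, cover hypothesis = chunk statements). -/
theorem bzAut_perm_lower_of_chunkCovered {Hsyn Hstab : List ℕ} {rcY rcS : RankCert} {L Ld : List ℕ} {s : BZSide}
    {wmax : ℕ} {found : List (ℕ × List ℕ)}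
    (hcomm : rowMatrix n Hsyn * (rowMatrix n Hstab)ᵀ = 0) (hfound : foundOK Hstab found = true)
    (hcore : bzCoreOK n Hsyn Hstab rcY rcS L Ld s.evenWitness = true) (hlen : bzLenOK Hstab rcS L s = true)
    (hb : ∀ b : ℕ, b < s.blocks.length → bzBlockOK n Hstab rcS L wmax (found.map Prod.fst) s b = true)
    {gens : List AutGen} (hgens : autGensOK n Hsyn Hstab gens = true)
    {words : List (List ℕ)} (hwords : autWordsOK gens.length words = true)
    (cuts : List ℕ) (hne : cuts ≠ []) (h0 : cuts.head hne = 0) (hlast : cuts.getLast hne = 2 ^ L.length)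
    (hch : ∀ (i : ℕ) (hi : i + 1 < cuts.length),
      ChunkCovered n Ld L (autPerms gens) words s.blocks cuts[i] cuts[i + 1])
    (w : Fin n → ZMod 2) (hw : rowMatrix n Hsyn *ᵥ w = 0) (hw' : w ∉ rowSpace (rowMatrix n Hstab)) :
    wmax < hammingNorm w :=
  bzAut_lower_sound (s := s) hcomm hfound hcore hlen hb _ _ (bzAut_perm_hφ hcomm hcore hgens hwords)
    (bzAut_perm_hcover_of_chunkCovered hgens hwords cuts hne h0 hlast hch) w hw hw'

/-- **Closer over chunks, lane-agnostic** (as `bzAut_perm_lower_sem`). -/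
theorem bzAut_perm_lower_sem_of_chunkCovered {Hsyn Hstab : List ℕ} {rcY rcS : RankCert} {L Ld : List ℕ}
    {s : BZSide} {wmax : ℕ}
    (hcomm : rowMatrix n Hsyn * (rowMatrix n Hstab)ᵀ = 0)
    (hcore : bzCoreOK n Hsyn Hstab rcY rcS L Ld s.evenWitness = true)
    (hblock : ∀ (b : Fin s.blocks.length) (z : Fin n → ZMod 2), rowMatrix n Hsyn *ᵥ z = 0 →
      z ∉ rowSpace (rowMatrix n Hstab) → ldMat n L Ld *ᵥ z ∈ Submodule.span (ZMod 2)
        (Set.range fun l : Fin (s.blocks[b]).W.length => ofBits L.length (s.blocks[b]).W[l]) →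
      wEff wmax s.evenWitness < hammingNorm z)
    {gens : List AutGen} (hgens : autGensOK n Hsyn Hstab gens = true)
    {words : List (List ℕ)} (hwords : autWordsOK gens.length words = true)
    (cuts : List ℕ) (hne : cuts ≠ []) (h0 : cuts.head hne = 0) (hlast : cuts.getLast hne = 2 ^ L.length)
    (hch : ∀ (i : ℕ) (hi : i + 1 < cuts.length),
      ChunkCovered n Ld L (autPerms gens) words s.blocks cuts[i] cuts[i + 1])
    (w : Fin n → ZMod 2) (hw : rowMatrix n Hsyn *ᵥ w = 0) (hw' : w ∉ rowSpace (rowMatrix n Hstab)) :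
    wmax < hammingNorm w :=
  bzAut_lower_sound_sem (s := s) hcomm hcore hblock _ _ (bzAut_perm_hφ hcomm hcore hgens hwords)
    (bzAut_perm_hcover_of_chunkCovered hgens hwords cuts hne h0 hlast hch) w hw hw'

end Chunks

/-! ## Smoke tests -/

/-- The two-logical swap example of `BZAutPermCover.lean` in the witnessed range form on the chunk `[2,4)`:
`witN = 0` (word `0` for both labels), `b = 1`; and a wrong witness width still only ACCEPTS sound covers. -/
example : coverAutPermWitRangeOK 2 [1, 2] [1, 2] [[1, 0]] [[0]] [⟨[1], []⟩, ⟨[3], []⟩] 2 4 0 1 = true ∧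
    coverAutPermWitRangeOK 2 [1, 2] [1, 2] [[1, 0]] [] [⟨[1], []⟩, ⟨[3], []⟩] 2 4 0 1 = false := by decide

/-- `witIdx` reads packed fields: `witN = 0b10_01_11` with `b = 2` from label `5` has fields `3, 1, 2`. -/
example : witIdx 39 2 5 5 = 3 ∧ witIdx 39 2 5 6 = 1 ∧ witIdx 39 2 5 7 = 2 := by decide

end Summit.Ventures.QEC.Census
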